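import Literature.Analysis.FluidPDE.NormalisedPressureL2Bound
import Literature.Analysis.FluidPDE.VorticityStretching
import Literature.Analysis.FluidPDE.TaoEnstrophyLocalisationProofs
import HarnessLib

/-!
# Calculus for the local Biot–Savart law: `Δu = -curl curl u`, coordinates, and the scaled
# smoothing kernel

Analysis/FluidPDE support file (first half of the local Biot–Savart law used in the proof of the
nonlinear estimate `Y₆` of Tao 2011, §10, proof of Thm. 10.1, arXiv:1108.1165 pp. 32–33: "we first
observe from the divergence-free nature of `u` that `Δu = ∇ × ∇ × u = ∇ × ω`" — up to sign —
"Let `ψᵢ` be a smooth cutoff […] On `2Bᵢ`, we thus have the local Biot-Savart law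
`u = O(Δ⁻¹∇(ψᵢω)) + v`"). Elementary pointwise facts:

* `laplacian_eq_neg_curl_curl` — **`Δu = -curl (curl u)`** for a divergence-free `C²` field on
  `ℝ³` (the classical identity `curl curl = ∇div - Δ`, Majda–Bertozzi §2.1 (2.4)/(1.11); proved in
  coordinates from the symmetry of `D²u` and `∂ⱼ div u = 0`);
* coordinates: `(Dw(y)v)_b = D(w_b)(y)v` (`fderiv_apply_coord`), the components of `curl` as
  differences of partial derivatives of components (`curl_coord_zero/one/two`), `‖L‖ ≤ Σₖₘ |(L eₖ)ₘ|`
  (`opNorm_le_sum_abs_coord`), `‖w‖ ≤ Σₘ |wₘ|` (`norm_le_sum_abs_coord`);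
* the **scaled smoothing kernel** `λ_r = newtonFarLaplacian (r/2) r = r⁻³λ₁(·/r)`: its directional
  derivatives are `∂ₖλ_r = r⁻⁴(∂ₖλ₁)(·/r)` with `∫|∂ₖλ_r| = r⁻¹∫|∂ₖλ₁|` and
  `∫|∂ₖλ_r|² = r⁻⁵∫|∂ₖλ₁|²` (`integral_abs_fderiv_newtonFarLaplacian_half`,
  `integral_sq_fderiv_newtonFarLaplacian_half`) — the source of Tao's factors `rᵢ⁻¹‖u‖_{L^∞}` and
  `rᵢ^{-5/2}‖u‖_{L²(2Bᵢ)}` for the harmonic remainder, here realised by the explicit smoothing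
  operator `Λ` of `NewtonLocalPotential` instead of the mean-value property.

## References

* T. Tao, arXiv:1108.1165 (`Tao2011`), §10, proof of Thm. 10.1 (p. 32).
* A. J. Majda, A. L. Bertozzi, *Vorticity and Incompressible Flow*, CUP 2002, §2.1 and §2.4.1
  (`-Δ = curl curl` on divergence-free fields; the Biot–Savart law).
-/

noncomputable section

open MeasureTheory Set Filter Topology Function Metric InnerProductSpace
open scoped ENNReal NNReal RealInnerProductSpace ContDiff Laplacian

namespace Literature.Analysis.FluidPDE

/-- Local notation for physical space `ℝ³ = EuclideanSpace ℝ (Fin 3)`. -/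
local notation "ℝ³" => EuclideanSpace ℝ (Fin 3)

/-- Local notation for the standard basis vectors. -/
local notation "𝐞" j => EuclideanSpace.single (j : Fin 3) (1 : ℝ)

/-! ### Coordinates -/

section Coord

/-- The derivative of a component is the component of the derivative:
`D(w_b)(y) v = (Dw(y) v)_b`. [folklore] -/
theorem fderiv_apply_coord {w : ℝ³ → ℝ³} {y : ℝ³} (hw : DifferentiableAt ℝ w y) (v : ℝ³)
    (b : Fin 3) : fderiv ℝ (fun z => w z b) y v = fderiv ℝ w y v b := by
  have h : HasFDerivAt (fun z => w z b)
      ((EuclideanSpace.proj b : ℝ³ →L[ℝ] ℝ).comp (fderiv ℝ w y)) y :=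
    (EuclideanSpace.proj b : ℝ³ →L[ℝ] ℝ).hasFDerivAt.comp y hw.hasFDerivAt
  rw [h.fderiv]
  rfl

/-- Components of a `Cⁿ` field are `Cⁿ`. [folklore] -/
theorem contDiff_apply_coord {w : ℝ³ → ℝ³} {n : WithTop ℕ∞} (hw : ContDiff ℝ n w) (b : Fin 3) :
    ContDiff ℝ n fun z => w z b :=
  (EuclideanSpace.proj b : ℝ³ →L[ℝ] ℝ).contDiff.comp hw

/-- The zeroth component of the curl: `(curl v)_0 = ∂₁v₂ - ∂₂v₁`. [folklore] -/
theorem curl_coord_zero {v : ℝ³ → ℝ³} {y : ℝ³} (hv : DifferentiableAt ℝ v y) :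
    curl v y 0 = fderiv ℝ (fun z => v z 2) y (𝐞 1) - fderiv ℝ (fun z => v z 1) y (𝐞 2) := by
  rw [curl_eq_curlCLM, curlCLM_apply, fderiv_apply_coord hv, fderiv_apply_coord hv]
  simp

/-- The first component of the curl: `(curl v)_1 = ∂₂v₀ - ∂₀v₂`. [folklore] -/
theorem curl_coord_one {v : ℝ³ → ℝ³} {y : ℝ³} (hv : DifferentiableAt ℝ v y) :
    curl v y 1 = fderiv ℝ (fun z => v z 0) y (𝐞 2) - fderiv ℝ (fun z => v z 2) y (𝐞 0) := by
  rw [curl_eq_curlCLM, curlCLM_apply, fderiv_apply_coord hv, fderiv_apply_coord hv]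
  simp

/-- The second component of the curl: `(curl v)_2 = ∂₀v₁ - ∂₁v₀`. [folklore] -/
theorem curl_coord_two {v : ℝ³ → ℝ³} {y : ℝ³} (hv : DifferentiableAt ℝ v y) :
    curl v y 2 = fderiv ℝ (fun z => v z 1) y (𝐞 0) - fderiv ℝ (fun z => v z 0) y (𝐞 1) := by
  rw [curl_eq_curlCLM, curlCLM_apply, fderiv_apply_coord hv, fderiv_apply_coord hv]
  simp

/-- `‖w‖ ≤ Σₘ |wₘ|` on `ℝ³` (`ℓ²` norm at most `ℓ¹` norm). [folklore] -/
theorem norm_le_sum_abs_coord (w : ℝ³) : ‖w‖ ≤ ∑ m, |w m| := by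
  have h1 : ‖w‖ ^ 2 = ∑ m, |w m| ^ 2 := by
    rw [EuclideanSpace.norm_eq, Real.sq_sqrt (Finset.sum_nonneg fun _ _ => sq_nonneg _)]
    simp only [Real.norm_eq_abs]
  have h2 : ∑ m, |w m| ^ 2 ≤ (∑ m, |w m|) ^ 2 :=
    Finset.sum_sq_le_sq_sum_of_nonneg fun _ _ => abs_nonneg _
  have hS : 0 ≤ ∑ m, |w m| := Finset.sum_nonneg fun m _ => abs_nonneg (w m)
  exact (pow_le_pow_iff_left₀ (norm_nonneg w) hS two_ne_zero).1 (h1 ▸ h2)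

/-- `‖L‖ ≤ Σₖ Σₘ |(L eₖ)ₘ|` for a linear map of `ℝ³` (operator norm at most the `ℓ¹` norm of the
matrix entries). [folklore] -/
theorem opNorm_le_sum_abs_coord (L : ℝ³ →L[ℝ] ℝ³) : ‖L‖ ≤ ∑ k, ∑ m, |L (𝐞 k) m| := by
  refine ContinuousLinearMap.opNorm_le_bound _
    (Finset.sum_nonneg fun k _ => Finset.sum_nonneg fun m _ => abs_nonneg _) fun v => ?_
  have hv : L v = ∑ k, v k • L (𝐞 k) := by
    have hrepr : v = ∑ k, v k • (𝐞 k) := by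
      simpa using ((EuclideanSpace.basisFun (Fin 3) ℝ).sum_repr v).symm
    conv_lhs => rw [hrepr]
    simp [map_sum, map_smul]
  have hvk : ∀ k, |v k| ≤ ‖v‖ := fun k => by
    simpa [Real.norm_eq_abs] using PiLp.norm_apply_le v k
  calc ‖L v‖ = ‖∑ k, v k • L (𝐞 k)‖ := by rw [hv]
    _ ≤ ∑ k, ‖v k • L (𝐞 k)‖ := norm_sum_le _ _
    _ = ∑ k, |v k| * ‖L (𝐞 k)‖ := by simp [norm_smul, Real.norm_eq_abs]
    _ ≤ ∑ k, ‖v‖ * ∑ m, |L (𝐞 k) m| := Finset.sum_le_sum fun k _ =>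
        mul_le_mul (hvk k) (norm_le_sum_abs_coord _) (norm_nonneg _) (norm_nonneg _)
    _ = (∑ k, ∑ m, |L (𝐞 k) m|) * ‖v‖ := by rw [← Finset.mul_sum, mul_comm]

end Coord

/-! ### `Δu = -curl (curl u)` for divergence-free fields -/

section CurlCurl

/-- **`curl (curl u) = -Δu` for a divergence-free `C²` field on `ℝ³`** (the identity
`curl curl = ∇ div - Δ`, Majda–Bertozzi, *Vorticity and Incompressible Flow*, §2.4.1, proof of
Prop. 2.16: "`-Δv = curl ω`" for `div v = 0`). Proof in coordinates: with `B = D²u(x)` (symmetric)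
both sides are explicit combinations of the entries `(B eⱼ eₖ)ᵢ`, and `Σₘ (B eⱼ eₘ)ₘ = ∂ⱼ div u = 0`.
[cite: MajdaBertozziCUP2002, Prop. 2.16 (proof)] -/
theorem curl_curl_eq_neg_laplacian {u : ℝ³ → ℝ³} (hu : ContDiff ℝ 2 u)
    (hdiv : VectorCalculus.IsDivFree u) (x : ℝ³) : curl (curl u) x = -(Δ u) x := by
  set B := fderiv ℝ (fderiv ℝ u) x with hB
  -- symmetry of the second derivative
  have hs : ∀ a c : ℝ³, B a c = B c a := fun a c =>
    (hu.contDiffAt.isSymmSndFDerivAt (n := 2) (by simp)) a c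
  have hs' : ∀ j k i : Fin 3, B (𝐞 j) (𝐞 k) i = B (𝐞 k) (𝐞 j) i := fun j k i => by rw [hs]
  -- `curl curl u` through `B`
  have h1 : curl (curl u) x = curlCLM (curlCLM.comp B) := by
    rw [curl_eq_curlCLM, fderiv_curl hu]
  -- `Δu` through `B`
  have h2 : (Δ u) x = ∑ j, B (𝐞 j) (𝐞 j) := by
    rw [laplacian_eq_sum_fderiv_fderiv (EuclideanSpace.basisFun (Fin 3) ℝ) hu x]
    refine Finset.sum_congr rfl fun j _ => ?_
    rw [fderiv_fderiv_apply_eq hu]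
    simp [hB]
  -- `∂ⱼ div u = 0` through `B`
  have h3 : ∀ j : Fin 3, B (𝐞 j) (𝐞 0) 0 + B (𝐞 j) (𝐞 1) 1 + B (𝐞 j) (𝐞 2) 2 = 0 := fun j => by
    have h := (hdiv.fderiv_apply hu (𝐞 j)) x
    rw [divergence_eq_traceCLM, fderiv_fderiv_apply_eq hu, traceCLM_apply, trace_eq_sum_coord,
      Fin.sum_univ_three] at h
    exact h
  rw [h1, h2]
  have e0 := h3 0; have e1 := h3 1; have e2 := h3 2
  ext i
  fin_cases i <;>
    simp [curlCLM_apply, Fin.sum_univ_three] <;>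
    linarith [hs' 0 1 0, hs' 0 1 1, hs' 0 1 2, hs' 0 2 0, hs' 0 2 1, hs' 0 2 2,
      hs' 1 2 0, hs' 1 2 1, hs' 1 2 2]

/-- **`Δu = -curl (curl u)`** for a divergence-free `C²` field on `ℝ³`. [cite: MajdaBertozziCUP2002, Prop. 2.16 (proof)] -/
theorem laplacian_eq_neg_curl_curl {u : ℝ³ → ℝ³} (hu : ContDiff ℝ 2 u)
    (hdiv : VectorCalculus.IsDivFree u) (x : ℝ³) : (Δ u) x = -curl (curl u) x := by
  rw [curl_curl_eq_neg_laplacian hu hdiv x, neg_neg]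

/-- Componentwise: `(Δu)ₘ(x) = Δ(uₘ)(x) = -(curl curl u)ₘ(x)`. [folklore] -/
theorem laplacian_coord_eq_neg_curl_curl {u : ℝ³ → ℝ³} (hu : ContDiff ℝ 2 u)
    (hdiv : VectorCalculus.IsDivFree u) (x : ℝ³) (m : Fin 3) :
    (Δ (fun z => u z m)) x = -(curl (curl u) x m) := by
  have h := ContDiffAt.laplacian_CLM_comp_left (l := (EuclideanSpace.proj m : ℝ³ →L[ℝ] ℝ))
    (hu.contDiffAt (x := x))
  have h' : (Δ (fun z => u z m)) x = (Δ u) x m := h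
  rw [h', laplacian_eq_neg_curl_curl hu hdiv x]
  simp

end CurlCurl

/-! ### The scaled smoothing kernel `λ_r = newtonFarLaplacian (r/2) r` and its gradient -/

section Kernel

variable {r : ℝ}

/-- The unit-scale smoothing kernel `λ₁ = newtonFarLaplacian (1/2) 1`. [folklore] -/
def lamOne : ℝ³ → ℝ := newtonFarLaplacian (1 / 2) 1

/-- Unfolding `λ₁`. [folklore] -/
theorem lamOne_def : lamOne = newtonFarLaplacian (1 / 2) 1 := rfl

/-- `λ₁` is smooth. [folklore] -/
theorem contDiff_lamOne {n : ℕ∞} : ContDiff ℝ n lamOne := by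
  rw [lamOne_def]; exact contDiff_newtonFarLaplacian (by norm_num) (by norm_num)

/-- `λ₁` has compact support. [folklore] -/
theorem hasCompactSupport_lamOne : HasCompactSupport lamOne := by
  rw [lamOne_def]; exact hasCompactSupport_newtonFarLaplacian (by norm_num) (by norm_num)

/-- The directional derivative `∂ₐλ₁` is continuous. [folklore] -/
theorem continuous_fderiv_lamOne_apply (a : ℝ³) : Continuous fun z => fderiv ℝ lamOne z a :=
  ((contDiff_lamOne (n := 1)).continuous_fderiv one_ne_zero).clm_apply continuous_const

/-- The directional derivative `∂ₐλ₁` has compact support. [folklore] -/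
theorem hasCompactSupport_fderiv_lamOne_apply (a : ℝ³) :
    HasCompactSupport fun z => fderiv ℝ lamOne z a :=
  hasCompactSupport_lamOne.fderiv_apply ℝ a

/-- `∂ₐλ₁ ∈ L¹`. [folklore] -/
theorem integrable_fderiv_lamOne_apply (a : ℝ³) : Integrable fun z => fderiv ℝ lamOne z a :=
  (continuous_fderiv_lamOne_apply a).integrable_of_hasCompactSupport
    (hasCompactSupport_fderiv_lamOne_apply a)

/-- `∂ₐλ₁ ∈ L²`. [folklore] -/
theorem integrable_sq_fderiv_lamOne_apply (a : ℝ³) :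
    Integrable fun z => (fderiv ℝ lamOne z a) ^ 2 := by
  have h2 : HasCompactSupport fun z => fderiv ℝ lamOne z a * fderiv ℝ lamOne z a :=
    (hasCompactSupport_fderiv_lamOne_apply a).mul_right
  have hc := continuous_fderiv_lamOne_apply a
  have h3 : Integrable (fun z => fderiv ℝ lamOne z a * fderiv ℝ lamOne z a) :=
    (hc.mul hc).integrable_of_hasCompactSupport h2
  simpa only [sq] using h3

/-- **Scaling of the smoothing kernel**: `λ_r(z) = r⁻³ λ₁(z/r)` for the radii `(r/2, r)`. [folklore] -/
theorem newtonFarLaplacian_half_eq (hr : 0 < r) :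
    newtonFarLaplacian (r / 2) r = fun z : ℝ³ => r⁻¹ ^ 3 * lamOne (r⁻¹ • z) := by
  funext z
  have h := newtonFarLaplacian_scale hr (1 / 2) 1 z
  rw [mul_one, show r * (1 / 2) = r / 2 by ring] at h
  rw [lamOne_def]
  exact h

/-- **Scaling of the gradient**: `∂ₐλ_r(z) = r⁻⁴ (∂ₐλ₁)(z/r)`. [folklore] -/
theorem fderiv_newtonFarLaplacian_half_apply (hr : 0 < r) (z a : ℝ³) :
    fderiv ℝ (newtonFarLaplacian (r / 2) r) z a = r⁻¹ ^ 4 * fderiv ℝ lamOne (r⁻¹ • z) a := by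
  rw [newtonFarLaplacian_half_eq hr]
  have h := fderiv_const_smul_comp_smul (lamOne) (r⁻¹ ^ 3) (b := r⁻¹) (inv_ne_zero hr.ne')
  simp only [smul_eq_mul] at h
  rw [h]
  show (r⁻¹ ^ 3 * r⁻¹) • (fderiv ℝ lamOne (r⁻¹ • z) a) = _
  rw [smul_eq_mul]
  ring

/-- `∫ |∂ₐλ_r| = r⁻¹ ∫ |∂ₐλ₁|`. [folklore] -/
theorem integral_abs_fderiv_newtonFarLaplacian_half (hr : 0 < r) (a : ℝ³) :
    ∫ z, |fderiv ℝ (newtonFarLaplacian (r / 2) r) z a| = r⁻¹ * ∫ z, |fderiv ℝ lamOne z a| := by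
  simp_rw [fderiv_newtonFarLaplacian_half_apply hr, abs_mul, abs_of_pos (by positivity : (0:ℝ) < r⁻¹ ^ 4),
    integral_const_mul]
  have h := Measure.integral_comp_inv_smul_of_nonneg volume
    (fun w : ℝ³ => |fderiv ℝ lamOne w a|) hr.le
  simp only [finrank_euclideanSpace_fin, smul_eq_mul] at h
  rw [h]
  field_simp

/-- `∫ |∂ₐλ_r|² = r⁻⁵ ∫ |∂ₐλ₁|²`. [folklore] -/
theorem integral_sq_fderiv_newtonFarLaplacian_half (hr : 0 < r) (a : ℝ³) :
    ∫ z, (fderiv ℝ (newtonFarLaplacian (r / 2) r) z a) ^ 2 =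
      r⁻¹ ^ 5 * ∫ z, (fderiv ℝ lamOne z a) ^ 2 := by
  simp_rw [fderiv_newtonFarLaplacian_half_apply hr, mul_pow, integral_const_mul]
  have h := Measure.integral_comp_inv_smul_of_nonneg volume
    (fun w : ℝ³ => (fderiv ℝ lamOne w a) ^ 2) hr.le
  simp only [finrank_euclideanSpace_fin, smul_eq_mul] at h
  rw [h]
  field_simp

/-- The `L¹` mass of the gradient of the unit smoothing kernel in the coordinate directions,
`C₁ = Σₖ ∫ |∂ₖλ₁|` (an absolute constant). [folklore] -/
def lamGradL1 : ℝ := ∑ k : Fin 3, ∫ z, |fderiv ℝ lamOne z (𝐞 k)|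

/-- The `L²` size of the gradient of the unit smoothing kernel in the coordinate directions,
`C₂ = Σₖ √(∫ |∂ₖλ₁|²)` (an absolute constant). [folklore] -/
def lamGradL2 : ℝ := ∑ k : Fin 3, Real.sqrt (∫ z, (fderiv ℝ lamOne z (𝐞 k)) ^ 2)

/-- `0 ≤ C₁`. [folklore] -/
theorem lamGradL1_nonneg : 0 ≤ lamGradL1 :=
  Finset.sum_nonneg fun _ _ => integral_nonneg fun _ => abs_nonneg _

/-- `0 ≤ C₂`. [folklore] -/
theorem lamGradL2_nonneg : 0 ≤ lamGradL2 :=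
  Finset.sum_nonneg fun _ _ => Real.sqrt_nonneg _

/-- `Σₖ ∫ |∂ₖλ_r| = C₁ / r`. [folklore] -/
theorem sum_integral_abs_fderiv_newtonFarLaplacian_half (hr : 0 < r) :
    ∑ k : Fin 3, ∫ z, |fderiv ℝ (newtonFarLaplacian (r / 2) r) z (𝐞 k)| = r⁻¹ * lamGradL1 := by
  simp_rw [integral_abs_fderiv_newtonFarLaplacian_half hr]
  rw [lamGradL1, Finset.mul_sum]

/-- `Σₖ √(∫ |∂ₖλ_r|²) = C₂ r^{-5/2}`. [folklore] -/
theorem sum_sqrt_integral_sq_fderiv_newtonFarLaplacian_half (hr : 0 < r) :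
    ∑ k : Fin 3, Real.sqrt (∫ z, (fderiv ℝ (newtonFarLaplacian (r / 2) r) z (𝐞 k)) ^ 2) =
      Real.sqrt (r⁻¹ ^ 5) * lamGradL2 := by
  simp_rw [integral_sq_fderiv_newtonFarLaplacian_half hr,
    Real.sqrt_mul (by positivity : (0:ℝ) ≤ r⁻¹ ^ 5)]
  rw [lamGradL2, Finset.mul_sum]

end Kernel


end Literature.Analysis.FluidPDE

end
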